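import Literature.Probability.LatticeModels.DiscreteFaceBoundary
import HarnessLib

/-!
# Winding numbers of closed walks of `Ω_δ`-edges: non-inner faces are outside — helper for `DiscretisationFamilyExists` (stmt-CriticalPhenomena-9644)

`DiscreteFaceBoundary.lean` proves, for closed PIECES OF THE BOUNDARY WALK (`bloop`), that a
non-inner face next to `Ω_δ` has combinatorial winding number zero when the domain is regular
(open, with connected unbounded exterior whose closure contains the frontier — every Jordan
domain, `regular_of_eq_carrier`).  The proofs use only that the steps of the walk are edges of
`Ω_δ`; this file records the same statements for an ARBITRARY closed lattice walk `c : ClosedWalk n`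
whose vertices `w j : Site 2` (`c.v j = toZ2 (w j)`) are consecutively `Ω_δ`-adjacent:

* `strace_subset_closure_of_adj` — the scaled trace lies in `closure Ω`;
* `disjoint_cell_strace_of_walk`, `exists_eq_v_of_meshPoint_mem_strace` — open cells miss the trace,
  a lattice point on the trace is a vertex (hence in `Ω_δ`);
* `exists_exterior_mem_connectedComponentIn_of_adj` — the centre of a non-inner face cornered at a
  site of `Ω_δ` is joined to the exterior off the trace;
* `W_eq_zero_of_not_isInnerFace_of_adj` — **such a face has winding number zero**;
* `W_eq_of_not_step` — the winding number does not jump across a side that the walk traverses in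
  neither direction.

These are the two facts behind the cut lemma "every cycle of boundary edges through `e_a` passes
through `e_b`" of the construction.
-/

noncomputable section

namespace Summit.CriticalPhenomena.CardyFormulaZ2.Theorems.DiscretisationFamilyExists

open Set Metric Complex Literature.Probability.LatticeModels Literature.Topology.PlaneTopology
  Literature.Probability.LatticeModels.Mesh Literature.Probability.LatticeModels.DiscreteDobrushin

variable {n : ℕ}

/-! ### The scaled trace of a walk of `Ω_δ`-edges -/

/-- A point of the scaled trace lies on a scaled unit segment between two consecutive vertices,
horizontal or vertical (coordinates). [folklore] -/
theorem exists_coord_of_mem_strace' (c : ClosedWalk n) {δ : ℝ} {z : ℂ} (hz : z ∈ c.strace δ) :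
    ∃ t < n, ∃ z' ∈ segment ℝ (latC (c.v t)) (latC (c.v (t + 1))), z = (δ : ℂ) * z' ∧
      ((z'.im = (c.v t).2 ∧ z'.im = (c.v (t + 1)).2 ∧ min ((c.v t).1 : ℝ) (c.v (t + 1)).1 ≤ z'.re ∧
          z'.re ≤ max ((c.v t).1 : ℝ) (c.v (t + 1)).1) ∨
       (z'.re = (c.v t).1 ∧ z'.re = (c.v (t + 1)).1 ∧ min ((c.v t).2 : ℝ) (c.v (t + 1)).2 ≤ z'.im ∧
          z'.im ≤ max ((c.v t).2 : ℝ) (c.v (t + 1)).2)) := by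
  obtain ⟨z', hz', rfl⟩ := hz
  obtain ⟨t, ht, htz⟩ := c.mem_trace_iff.1 hz'
  exact ⟨t, ht, z', htz, rfl, coord_of_mem_segment_latC (c.adj t) htz⟩

/-- **Open cells miss the scaled trace** of any closed lattice walk (`δ > 0`). [folklore] -/
theorem disjoint_cell_strace_of_walk (c : ClosedWalk n) {δ : ℝ} (hδ : 0 < δ) (k j : ℤ) :
    Disjoint (Mesh.cell δ k j) (c.strace δ) := by
  rw [Set.disjoint_left]
  intro z hz hz'
  obtain ⟨t, -, z', -, rfl, hcoord⟩ := exists_coord_of_mem_strace' c hz'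
  rw [Mesh.mem_cell_iff] at hz
  simp only [Complex.mul_re, Complex.mul_im, Complex.ofReal_re, Complex.ofReal_im, zero_mul,
    sub_zero, add_zero] at hz
  obtain ⟨⟨h1, h2⟩, h3, h4⟩ := hz
  set P := c.v t
  rcases hcoord with ⟨hi, -, -, -⟩ | ⟨hr, -, -, -⟩
  · rw [hi] at h3 h4
    have h3' : (j : ℝ) < P.2 := by
      have := lt_of_mul_lt_mul_left h3 hδ.le; exact_mod_cast this
    have h4' : (P.2 : ℝ) < j + 1 := by
      have := lt_of_mul_lt_mul_left h4 hδ.le; exact_mod_cast this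
    have : (j : ℤ) < P.2 := by exact_mod_cast h3'
    have : P.2 < j + 1 := by exact_mod_cast h4'
    omega
  · rw [hr] at h1 h2
    have h1' : (k : ℝ) < P.1 := by
      have := lt_of_mul_lt_mul_left h1 hδ.le; exact_mod_cast this
    have h2' : (P.1 : ℝ) < k + 1 := by
      have := lt_of_mul_lt_mul_left h2 hδ.le; exact_mod_cast this
    have : (k : ℤ) < P.1 := by exact_mod_cast h1'
    have : P.1 < k + 1 := by exact_mod_cast h2'
    omega

/-- **A lattice point on the scaled trace is a vertex of the walk** (`δ > 0`). [folklore] -/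
theorem exists_eq_v_of_meshPoint_mem_strace (c : ClosedWalk n) {δ : ℝ} (hδ : 0 < δ) {u : Site 2}
    (hu : meshPoint δ u ∈ c.strace δ) : ∃ t, toZ2 u = c.v t := by
  obtain ⟨t, -, z', -, hz, hcoord⟩ := exists_coord_of_mem_strace' c hu
  have hδ0 : (δ : ℂ) ≠ 0 := by exact_mod_cast hδ.ne'
  rw [meshPoint_eq_mul_latC] at hz
  have hz' : latC (toZ2 u) = z' := mul_left_cancel₀ hδ0 hz
  rw [← hz'] at hcoord
  simp only [latC_re, latC_im, toZ2_mk] at hcoord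
  set P := c.v t with hP
  set Q := c.v (t + 1) with hQ
  have hPQ : RectLoop.Adj P Q := c.adj t
  have key : toZ2 u = P ∨ toZ2 u = Q := by
    simp only [toZ2_mk, Prod.ext_iff]
    rcases hcoord with ⟨hi, hi', hlo, hhi⟩ | ⟨hr, hr', hlo, hhi⟩
    · have h1 : u 1 = P.2 := by exact_mod_cast hi
      have h1' : u 1 = Q.2 := by exact_mod_cast hi'
      have hq : Q.1 = P.1 + 1 ∨ Q.1 = P.1 - 1 := by
        rcases (adj_iff P Q).1 hPQ with ⟨hq1, -⟩ | ⟨-, hq2⟩ | ⟨hq1, -⟩ | ⟨-, hq2⟩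
        · exact Or.inl hq1
        · exfalso; omega
        · exact Or.inr hq1
        · exfalso; omega
      rcases int_eq_or_eq_of_mem hq hlo hhi with h0 | h0
      · exact Or.inl ⟨h0, h1⟩
      · exact Or.inr ⟨h0, h1'⟩
    · have h0 : u 0 = P.1 := by exact_mod_cast hr
      have h0' : u 0 = Q.1 := by exact_mod_cast hr'
      have hq : Q.2 = P.2 + 1 ∨ Q.2 = P.2 - 1 := by
        rcases (adj_iff P Q).1 hPQ with ⟨hq1, -⟩ | ⟨-, hq2⟩ | ⟨hq1, -⟩ | ⟨-, hq2⟩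
        · exfalso; omega
        · exact Or.inl hq2
        · exfalso; omega
        · exact Or.inr hq2
      rcases int_eq_or_eq_of_mem hq hlo hhi with h1 | h1
      · exact Or.inl ⟨h0, h1⟩
      · exact Or.inr ⟨h0', h1⟩
  rcases key with h | h
  · exact ⟨t, h⟩
  · exact ⟨t + 1, h⟩

variable {E : DiscreteDobrushin}

/-- **The scaled trace of a closed walk of `Ω_δ`-edges lies in `closure Ω`** (its steps are mesh
edges). [folklore] -/
theorem strace_subset_closure_of_adj (c : ClosedWalk n) (w : ℕ → Site 2) (hw : ∀ j, c.v j = toZ2 (w j))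
    (hadj : ∀ j, (discreteDomainGraph E.Ω E.δ).Adj (w j) (w (j + 1))) : c.strace E.δ ⊆ closure E.Ω := by
  intro z hz
  obtain ⟨t, -, ht⟩ := c.mem_strace_iff.1 hz
  rw [hw t, hw (t + 1), ← meshPoint_eq_mul_latC, ← meshPoint_eq_mul_latC] at ht
  exact (meshGraph_adj_iff.1 (discreteDomainGraph_adj_iff.1 (hadj t)).1).2 ht

/-- The vertices of a closed walk of `Ω_δ`-edges lie in `Ω_δ`. [folklore] -/
theorem mem_meshDomain_of_adj (w : ℕ → Site 2)
    (hadj : ∀ j, (discreteDomainGraph E.Ω E.δ).Adj (w j) (w (j + 1))) (j : ℕ) :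
    w j ∈ meshDomain E.Ω E.δ :=
  (discreteDomainGraph_adj_iff.1 (hadj j)).2.1

/-- A lattice point on the scaled trace of a closed walk of `Ω_δ`-edges lies in `Ω_δ`. [folklore] -/
theorem mem_meshDomain_of_meshPoint_mem_strace' (hδ : 0 < E.δ) (c : ClosedWalk n) (w : ℕ → Site 2)
    (hw : ∀ j, c.v j = toZ2 (w j)) (hadj : ∀ j, (discreteDomainGraph E.Ω E.δ).Adj (w j) (w (j + 1)))
    {u : Site 2} (hu : meshPoint E.δ u ∈ c.strace E.δ) : u ∈ meshDomain E.Ω E.δ := by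
  obtain ⟨t, ht⟩ := exists_eq_v_of_meshPoint_mem_strace c hδ hu
  rw [hw t] at ht
  rw [toZ2_injective ht]
  exact mem_meshDomain_of_adj w hadj t

/-! ### Non-inner faces have winding number zero -/

/-- The centre of the cell of a face is joined, off the scaled trace of any closed lattice walk,
to every point of the closed cell off the trace. [folklore] -/
theorem mem_connectedComponentIn_of_mem_closure_cell' (c : ClosedWalk n) {δ : ℝ} (hδ : 0 < δ)
    {F : Site 2} {p : ℂ} (hp : p ∈ closure (Mesh.cell δ (F 0) (F 1))) (hpr : p ∉ c.strace δ) :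
    p ∈ connectedComponentIn (c.strace δ)ᶜ (Mesh.cellCenter δ (F 0) (F 1)) := by
  set z₀ := Mesh.cellCenter δ (F 0) (F 1)
  have hz₀ : z₀ ∈ Mesh.cell δ (F 0) (F 1) := Mesh.cellCenter_mem_cell hδ _ _
  have hdis := disjoint_cell_strace_of_walk c hδ (F 0) (F 1)
  have hsub : segment ℝ z₀ p ⊆ (c.strace δ)ᶜ := by
    rw [← insert_endpoints_openSegment]
    intro z hz
    rcases hz with rfl | rfl | hz
    · exact Set.disjoint_left.1 hdis hz₀
    · exact hpr
    · exact Set.disjoint_left.1 hdis (Mesh.openSegment_subset_cell_of_mem_closure _ _ hz₀ hp hz)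
  exact (convex_segment z₀ p).isPreconnected.subset_connectedComponentIn (left_mem_segment ℝ z₀ p) hsub
    (right_mem_segment ℝ z₀ p)

/-- **An exterior point joined to the centre of a non-inner face next to `Ω_δ`**, off the scaled
trace of a closed walk of `Ω_δ`-edges (through the exit witness of the face), for open `Ω` whose
frontier lies in the closure of the exterior. [folklore] -/
theorem exists_exterior_mem_connectedComponentIn_of_adj (hδ : 0 < E.δ) (c : ClosedWalk n)
    (w : ℕ → Site 2) (hw : ∀ j, c.v j = toZ2 (w j))
    (hadj : ∀ j, (discreteDomainGraph E.Ω E.δ).Adj (w j) (w (j + 1)))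
    (hΩo : IsOpen E.Ω) (hfr : frontier E.Ω ⊆ closure (closure E.Ω)ᶜ)
    {F : Site 2} (hF : ¬ E.IsInnerFace F) {x₀ : Site 2} (hx₀ : IsCorner x₀ F)
    (hx₀D : x₀ ∈ meshDomain E.Ω E.δ) :
    ∃ q ∈ (closure E.Ω)ᶜ, q ∈ connectedComponentIn (c.strace E.δ)ᶜ (Mesh.cellCenter E.δ (F 0) (F 1)) := by
  have hrange := strace_subset_closure_of_adj c w hw hadj
  rcases exists_witness_of_not_isInnerFace hF hx₀ hx₀D with ⟨v, v', hv, hv', -, hseg⟩ | ⟨u, hu, huV⟩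
  · obtain ⟨p, hp, hpΩ⟩ := Set.not_subset.1 hseg
    refine ⟨p, hpΩ, mem_connectedComponentIn_of_mem_closure_cell' c hδ ?_ fun h => hpΩ (hrange h)⟩
    exact segment_subset_closure_cell_of_isCorner hδ hv hv' hp
  · have hup : meshPoint E.δ u ∉ c.strace E.δ := fun h =>
      huV (meshDomain_subset_meshVertices _ _ (mem_meshDomain_of_meshPoint_mem_strace' hδ c w hw hadj h))
    have hu1 := mem_connectedComponentIn_of_mem_closure_cell' c hδ (meshPoint_mem_closure_cell_of_isCorner hδ hu) hup
    have hopen : IsOpen (c.strace E.δ)ᶜ := (c.isCompact_strace E.δ).isClosed.isOpen_compl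
    obtain ⟨r, hr, hball⟩ := Metric.isOpen_iff.1 hopen _ hup
    obtain ⟨q, hqb, hqE⟩ := Mesh.exists_mem_exterior_of_isOpen hΩo hfr Metric.isOpen_ball
      (Metric.mem_ball_self hr) huV
    refine ⟨q, hqE, ?_⟩
    rw [connectedComponentIn_eq hu1]
    exact (convex_ball _ _).isPreconnected.subset_connectedComponentIn (Metric.mem_ball_self hr) hball hqb

/-- **Non-inner faces next to `Ω_δ` have winding number zero for every closed walk of
`Ω_δ`-edges**, when `Ω` is open with a connected, unbounded exterior whose closure contains `∂Ω`
(every Jordan domain): the centre of the face is joined to the exterior off the trace, the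
exterior misses the trace (which lies in `closure Ω`) and reaches infinity. [folklore] -/
theorem W_eq_zero_of_not_isInnerFace_of_adj (hn : 0 < n) (hδ : 0 < E.δ) (c : ClosedWalk n)
    (w : ℕ → Site 2) (hw : ∀ j, c.v j = toZ2 (w j))
    (hadj : ∀ j, (discreteDomainGraph E.Ω E.δ).Adj (w j) (w (j + 1)))
    (hΩo : IsOpen E.Ω) (hext : IsConnected (closure E.Ω)ᶜ) (hunb : ¬ Bornology.IsBounded (closure E.Ω)ᶜ)
    (hfr : frontier E.Ω ⊆ closure (closure E.Ω)ᶜ)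
    {F : Site 2} (hF : ¬ E.IsInnerFace F) {x₀ : Site 2} (hx₀ : IsCorner x₀ F)
    (hx₀D : x₀ ∈ meshDomain E.Ω E.δ) : c.W (toZ2 F) = 0 := by
  apply c.W_eq_zero_of_joined_far hn hδ
  intro R
  obtain ⟨q, hqE, hqC⟩ := exists_exterior_mem_connectedComponentIn_of_adj hδ c w hw hadj hΩo hfr hF hx₀ hx₀D
  obtain ⟨z, hzE, hzR⟩ : ∃ z ∈ (closure E.Ω)ᶜ, R < ‖z‖ := by
    by_contra! h
    exact hunb ((Metric.isBounded_closedBall (x := (0 : ℂ)) (r := R)).subset fun z hz => by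
      simpa using h z hz)
  have hsub : (closure E.Ω)ᶜ ⊆ (c.strace E.δ)ᶜ :=
    Set.compl_subset_compl.2 (strace_subset_closure_of_adj c w hw hadj)
  have hz : z ∈ connectedComponentIn (c.strace E.δ)ᶜ q :=
    connectedComponentIn_mono q hsub (hext.isPreconnected.subset_connectedComponentIn hqE subset_rfl hzE)
  refine ⟨z, ?_, hzR⟩
  simp only [toZ2_mk]
  rw [connectedComponentIn_eq hqC]
  exact hz

/-! ### No jump across an untraversed side -/

/-- The step count of a pair that is never a step of the walk vanishes. [folklore] -/
theorem cnt_eq_zero_of_forall (c : ClosedWalk n) {P Q : ℤ × ℤ}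
    (h : ∀ j, ¬ (c.v j = P ∧ c.v (j + 1) = Q)) : c.cnt P Q = 0 :=
  Finset.sum_eq_zero fun j _ => by rw [indZ_of_neg (h j)]

/-- **No jump across an untraversed vertical side**: if neither `(a, q) → (a, q+1)` nor its reverse
is a step of the walk, the faces `(a - 1, q)` and `(a, q)` have the same winding number. [folklore] -/
theorem W_eq_of_not_step_vertical (c : ClosedWalk n) {a q : ℤ}
    (h1 : ∀ j, ¬ (c.v j = (a, q) ∧ c.v (j + 1) = (a, q + 1)))
    (h2 : ∀ j, ¬ (c.v j = (a, q + 1) ∧ c.v (j + 1) = (a, q))) :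
    c.W (a, q) = c.W (a - 1, q) := by
  have := c.W_succ_fst (a - 1) q
  rw [sub_add_cancel] at this
  rw [this, c.cV_eq_cnt, cnt_eq_zero_of_forall c h1, cnt_eq_zero_of_forall c h2]
  ring

/-- **No jump across an untraversed horizontal side**: if neither `(p, b) → (p+1, b)` nor its
reverse is a step of the walk, the faces `(p, b - 1)` and `(p, b)` have the same winding number.
[folklore] -/
theorem W_eq_of_not_step_horizontal (c : ClosedWalk n) {p b : ℤ}
    (h1 : ∀ j, ¬ (c.v j = (p, b) ∧ c.v (j + 1) = (p + 1, b)))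
    (h2 : ∀ j, ¬ (c.v j = (p + 1, b) ∧ c.v (j + 1) = (p, b))) :
    c.W (p, b) = c.W (p, b - 1) := by
  have := c.W_succ_snd p (b - 1)
  rw [sub_add_cancel] at this
  rw [this, c.cH_eq_cnt, cnt_eq_zero_of_forall c h1, cnt_eq_zero_of_forall c h2]
  ring

end Summit.CriticalPhenomena.CardyFormulaZ2.Theorems.DiscretisationFamilyExists

end
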